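import Mathlib
import HarnessLib
import Literature.Analysis.FluidPDE.LerayProfileCalculus
import Summits.NavierStokesRegularity.NavierStokesRegularity.Theorems.UnthreadedRigidityDoorUnthreadedRigidityVirialHornShellFields

/-!
# Route `UnthreadedRigidityDoor`, item `UnthreadedRigidity` (W2, stmt-NavierStokesRegularity-27585) — LINE g11-1 «VIRIAL HORN»:
# (F2) ORDER-TWO LAW, part 1 — the STRUCTURE of the second threading jet of a separable shell

For the centred separable shell `P = curl curl ((h(|y|²) Y) y)` (`h` smooth, `Y` a solid harmonic of degree `l ≥ 1`, `P` smooth and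
divergence free), its toroidal vorticity `ω = curl P = −K(|y|²)(∇Y × y)` (`…ShellFields`), and ANY smooth pressure slice `p`, put
`u₁ = ΔP − (P·∇)P − ∇p` (the formal tendency) and `F = curl u₁`.  Then:

* `polarized_lamb` — `(a·∇)b + (b·∇)a = ∇⟪a,b⟫ − a × curl b − b × curl a` (polarisation of the tree's Lamb form);
* `inner_curl_tendency_self_eq_zero` — `⟪F z, z⟫ = 0` for all `z` (LEMMA SEP: the first jet vanishes; `curl ∇p = 0`);
* `inner_curl_laplacian_tendency_self_eq_zero` — the VISCOUS part of the second jet vanishes: `⟪curl (Δu₁)(y), y⟫ = 0`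
  (`curl Δ = Δ curl`, `Δ⟪y, F⟫ = ⟪y, ΔF⟫ + 2 div F`, `⟪y, F⟫ ≡ 0`, `div F = 0`);
* ★ `fluxTwo_shell_structure` — the second formal threading jet of the shell is
  `⟪curl(Δu₁ − ((P·∇)u₁ + (u₁·∇)P))(y), y⟫ = l(l+1) h(|y|²) ⟪∇Y(y), F(y)⟫ + K(|y|²) {Y, ⟪u₁, ·⟫}(y)`
  (`{f,g} = pbr f g`; transport terms via `curl_cross_apply` against the tangent divergence-free fields `F`, `ω` and
  `⟪P, y⟫ = l(l+1) hY`, `D g[∇Y × y] = −{Y, g}`).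
Part 2 (the explicit evaluation `= K(α²{Y,|∇Y|²} − {Y, y·∇p})`, i.e. the typed `OrderTwoLawSlice` of the dss_146 split) builds on this.

HONEST LABEL: explicit-field calculus (an L-part) on a RUNG line about SPECIAL separable data; `UnthreadedRigidity` (27585), W2 and NS
regularity remain OPEN; no statement about Navier–Stokes solutions is proved.  `--supports stmt-NavierStokesRegularity-27585` (helper);
ns-crc-p2 g8.  [cite: MajdaBertozziCUP2002, §1.1 (vector identities), §2.1 (Lamb form)]
-/

-- the summit and its single sub-problem share the name (CONVENTIONS §1)
set_option linter.dupNamespace false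

namespace Summit.NavierStokesRegularity.NavierStokesRegularity.Theorems.UnthreadedRigidity.VirialHorn

open scoped Topology Laplacian
open Filter Set Function
open Summit.NavierStokesRegularity.NavierStokesRegularity.Theorems.UnthreadedRigidity.ProfileHorn (E3)
open Literature.Analysis.FluidPDE

/-! ## §1 Generic identities -/

/-- POLARISED LAMB FORM: `(a·∇)b + (b·∇)a = ∇⟪a,b⟫ − a × curl b − b × curl a` at a point where `a`, `b` are differentiable
(polarisation of `(v·∇)v = (curl v) × v + ∇(|v|²/2)`). [cite: MajdaBertozziCUP2002, §1.1 (vector identities)] -/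
theorem polarized_lamb {a b : E3 → E3} {x : E3} (ha : DifferentiableAt ℝ a x) (hb : DifferentiableAt ℝ b x) :
    convect a b x + convect b a x =
      gradient (fun z : E3 => inner ℝ (a z) (b z)) x - cross (a x) (curl b x) - cross (b x) (curl a x) := by
  have hab : DifferentiableAt ℝ (fun z => a z + b z) x := ha.add hb
  have h1 := convect_self_eq_cross_curl_add_gradient hab
  have h2 := convect_self_eq_cross_curl_add_gradient ha
  have h3 := convect_self_eq_cross_curl_add_gradient hb
  -- bilinearity of `convect`
  have hc : convect (fun z => a z + b z) (fun z => a z + b z) x =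
      convect a a x + convect b b x + (convect a b x + convect b a x) := by
    simp only [convect_apply, fderiv_fun_add ha hb, add_apply, map_add]
    abel
  -- the curl and the gradient of the sum
  have hcurl : curl (fun z => a z + b z) x = curl a x + curl b x := curl_add ha hb
  have hgrad : gradient (fun z : E3 => ‖a z + b z‖ ^ 2 / 2) x =
      gradient (fun z : E3 => ‖a z‖ ^ 2 / 2) x + gradient (fun z : E3 => ‖b z‖ ^ 2 / 2) x
        + gradient (fun z : E3 => inner ℝ (a z) (b z)) x := by
    have e : (fun z : E3 => ‖a z + b z‖ ^ 2 / 2) =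
        fun z => ‖a z‖ ^ 2 / 2 + ‖b z‖ ^ 2 / 2 + inner ℝ (a z) (b z) := by
      funext z
      rw [norm_add_sq_real]
      ring
    have d1 : DifferentiableAt ℝ (fun z : E3 => ‖a z‖ ^ 2 / 2) x := (hasFDerivAt_half_norm_sq ha).differentiableAt
    have d2 : DifferentiableAt ℝ (fun z : E3 => ‖b z‖ ^ 2 / 2) x := (hasFDerivAt_half_norm_sq hb).differentiableAt
    have d3 : DifferentiableAt ℝ (fun z : E3 => inner ℝ (a z) (b z)) x := ha.inner ℝ hb
    have d12 : DifferentiableAt ℝ (fun z : E3 => ‖a z‖ ^ 2 / 2 + ‖b z‖ ^ 2 / 2) x := d1.add d2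
    rw [e, gradient, fderiv_fun_add d12 d3, fderiv_fun_add d1 d2, map_add, map_add]
    rfl
  have hcross : cross (curl a x + curl b x) (a x + b x) =
      cross (curl a x) (a x) + cross (curl a x) (b x) + (cross (curl b x) (a x) + cross (curl b x) (b x)) := by
    simp only [← crossCLM_apply, map_add, add_apply]
    abel
  have e1 : convect a b x + convect b a x =
      convect (fun z => a z + b z) (fun z => a z + b z) x - convect a a x - convect b b x := by
    rw [hc]
    abel
  rw [e1, h1, h2, h3, hcurl, hgrad, hcross, cross_swap (curl a x) (b x), cross_swap (curl b x) (a x)]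
  abel

/-- The derivative of a function along the shell's rotation field `∇Y × y` is minus the bracket: `Dg(y)[∇Y(y) × y] = −{Y, g}(y)`. [folklore] -/
theorem fderiv_apply_cross_gradient_eq_neg_pbr (Y g : E3 → ℝ) (y : E3) :
    fderiv ℝ g y (cross (gradient Y y) y) = -pbr Y g y := by
  have e : ∀ v : E3, inner ℝ (gradient g y) v = fderiv ℝ g y v := fun v => by
    rw [gradient, InnerProductSpace.toDual_symm_apply]
  rw [← e, pbr, det3]
  simp only [cross, PiLp.inner_apply, RCLike.inner_apply, conj_trivial, Fin.sum_univ_three,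
    cross_apply, Matrix.cons_val_zero, Matrix.cons_val_one, Matrix.cons_val_two,
    Matrix.head_cons, Matrix.tail_cons]
  ring

/-! ## §2 The tendency of a shell: first-jet silence, vanishing viscous second jet, the structure of the second jet -/

section Shell

variable {h : ℝ → ℝ} {l : ℕ} {Y : E3 → ℝ} {P : E3 → E3} {c : ℝ → ℝ} {p : E3 → ℝ}

/-- THE TENDENCY REWRITTEN: for a smooth divergence-free field `P` with vorticity `ω = curl P` and a smooth `p`,
`ΔP − (P·∇)P − ∇p = −curl ω − ω × P − ∇(|P|²/2) − ∇p` pointwise. [cite: MajdaBertozziCUP2002, §2.1] -/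
theorem nsTendency_eq (hP : ContDiff ℝ (⊤ : ℕ∞) P) (hdiv : VectorCalculus.IsDivFree P) (p : E3 → ℝ) :
    ThreadingJets.nsTendency P p = fun z : E3 =>
      -curl (curl P) z - (cross (curl P z) (P z) + gradient (fun w : E3 => ‖P w‖ ^ 2 / 2) z) - gradient p z := by
  have hP2 : ContDiff ℝ 2 P := hP.of_le (by norm_cast)
  have hPd : Differentiable ℝ P := hP.differentiable (by simp)
  funext z
  unfold ThreadingJets.nsTendency
  rw [convect_self_eq_cross_curl_add_gradient (hPd z), curl_curl_eq_neg_laplacian hP2 hdiv z, neg_neg]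

/-- smoothness of the rewritten tendency. [folklore] -/
theorem contDiff_nsTendency (hP : ContDiff ℝ (⊤ : ℕ∞) P) (hdiv : VectorCalculus.IsDivFree P)
    (hp : ContDiff ℝ (⊤ : ℕ∞) p) : ContDiff ℝ (⊤ : ℕ∞) (ThreadingJets.nsTendency P p) := by
  rw [nsTendency_eq hP hdiv p]
  have hω : ContDiff ℝ (⊤ : ℕ∞) (curl P) := by
    have : ContDiff ℝ ((⊤ : ℕ∞) + 1) P := by simpa using hP
    exact contDiff_curl this
  have hcω : ContDiff ℝ (⊤ : ℕ∞) (curl (curl P)) := by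
    have : ContDiff ℝ ((⊤ : ℕ∞) + 1) (curl P) := by simpa using hω
    exact contDiff_curl this
  have hcross : ContDiff ℝ (⊤ : ℕ∞) (fun z : E3 => cross (curl P z) (P z)) := by
    have : ContDiff ℝ (⊤ : ℕ∞) (fun z : E3 => crossCLM (curl P z) (P z)) := crossCLM.contDiff.comp hω |>.clm_apply hP
    simpa only [crossCLM_apply] using this
  have hq : ContDiff ℝ (⊤ : ℕ∞) (fun w : E3 => ‖P w‖ ^ 2 / 2) := (hP.norm_sq ℝ).div_const 2
  have hgq : ContDiff ℝ (⊤ : ℕ∞) (gradient (fun w : E3 => ‖P w‖ ^ 2 / 2)) := contDiff_gradient_of_contDiff_top hq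
  have hgp : ContDiff ℝ (⊤ : ℕ∞) (gradient p) := contDiff_gradient_of_contDiff_top hp
  exact (hcω.neg.sub (hcross.add hgq)).sub hgp

/-- LEMMA SEP FOR THE TENDENCY: the curl of the formal tendency of a smooth divergence-free shell is TANGENT to the spheres,
`⟪curl(ΔP − (P·∇)P − ∇p)(z), z⟫ = 0` (`…ShellFields.inner_curl_fluxOne_shell_eq_zero`; the pressure gradient is curl free). -/
theorem inner_curl_nsTendency_self_eq_zero (hh : ContDiff ℝ (⊤ : ℕ∞) h) (hY : IsSolidHarmonic l Y) (hl : 1 ≤ l)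
    (hPe : P = curl (curl (fun z : E3 => (h (‖z‖ ^ 2) * Y z) • z)))
    (hP : ContDiff ℝ (⊤ : ℕ∞) P) (hdiv : VectorCalculus.IsDivFree P) (hp : ContDiff ℝ (⊤ : ℕ∞) p) (z : E3) :
    inner ℝ (curl (ThreadingJets.nsTendency P p) z) z = 0 := by
  have hP2 : ContDiff ℝ 2 P := hP.of_le (by norm_cast)
  have hp2 : ContDiff ℝ 2 p := hp.of_le (by norm_cast)
  -- differentiability of `ΔP − (P·∇)P` (through the rewritten form) and of `∇p`
  have hA : Differentiable ℝ (fun w : E3 => (Δ P) w - convect P P w) := by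
    have e : (fun w : E3 => (Δ P) w - convect P P w) = fun w => ThreadingJets.nsTendency P (fun _ => 0) w := by
      funext w
      unfold ThreadingJets.nsTendency
      have : gradient (fun _ : E3 => (0 : ℝ)) w = 0 := by
        rw [gradient, fderiv_const_apply, map_zero]
      rw [this, sub_zero]
    rw [e]
    exact (contDiff_nsTendency hP hdiv contDiff_const).differentiable (by simp)
  have hgp : Differentiable ℝ (gradient p) :=
    (contDiff_gradient_of_contDiff_top hp).differentiable (by simp)
  have e : ThreadingJets.nsTendency P p = fun w : E3 => ((Δ P) w - convect P P w) - gradient p w := rfl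
  rw [e, curl_sub (hA z) (hgp z), curl_gradient_eq_zero_holds p hp2 z, sub_zero]
  exact inner_curl_fluxOne_shell_eq_zero hh hY hl hPe hP hdiv z

/-- THE VISCOUS PART OF THE SECOND JET VANISHES: `⟪curl (Δu₁)(y), y⟫ = 0` for the formal tendency `u₁` of a smooth
divergence-free shell (`curl Δ = Δ curl`, `Δ⟪y, F⟫ = ⟪y, ΔF⟫ + 2 div F` with `F = curl u₁` tangent and divergence free). -/
theorem inner_curl_laplacian_nsTendency_self_eq_zero (hh : ContDiff ℝ (⊤ : ℕ∞) h) (hY : IsSolidHarmonic l Y) (hl : 1 ≤ l)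
    (hPe : P = curl (curl (fun z : E3 => (h (‖z‖ ^ 2) * Y z) • z)))
    (hP : ContDiff ℝ (⊤ : ℕ∞) P) (hdiv : VectorCalculus.IsDivFree P) (hp : ContDiff ℝ (⊤ : ℕ∞) p) (y : E3) :
    inner ℝ (curl (Δ (ThreadingJets.nsTendency P p)) y) y = 0 := by
  have hu : ContDiff ℝ (⊤ : ℕ∞) (ThreadingJets.nsTendency P p) := contDiff_nsTendency hP hdiv hp
  have hu3 : ContDiff ℝ 3 (ThreadingJets.nsTendency P p) := hu.of_le (by norm_cast)
  have hF : ContDiff ℝ (⊤ : ℕ∞) (curl (ThreadingJets.nsTendency P p)) := by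
    have : ContDiff ℝ ((⊤ : ℕ∞) + 1) (ThreadingJets.nsTendency P p) := by simpa using hu
    exact contDiff_curl this
  have hF2 : ContDiff ℝ 2 (curl (ThreadingJets.nsTendency P p)) := hF.of_le (by norm_cast)
  rw [curl_laplacian hu3 y]
  have hid := laplacian_inner_id_eq hF2 y
  have hzero : (fun z : E3 => inner ℝ z (curl (ThreadingJets.nsTendency P p) z)) = fun _ => (0 : ℝ) := by
    funext z
    rw [real_inner_comm]
    exact inner_curl_nsTendency_self_eq_zero hh hY hl hPe hP hdiv hp z
  have hΔ0 : (Δ (fun _ : E3 => (0 : ℝ))) y = 0 := congrFun (InnerProductSpace.laplacian_const (E := E3) (c := (0 : ℝ))) y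
  rw [hzero, hΔ0, divergence_curl_eq_zero_holds _ (hu.of_le (by norm_cast)) y, mul_zero, add_zero] at hid
  rw [real_inner_comm]
  exact hid.symm

/-- ★ THE STRUCTURE OF THE SECOND JET OF A SHELL: with `u₁ = ΔP − (P·∇)P − ∇p`, `F = curl u₁`, and the toroidal vorticity
`curl P = −c(|y|²)(∇Y × y)`, the second formal threading jet about the centre is
`fluxJetTwo P p 0 y = l(l+1) h(|y|²) ⟪∇Y(y), F(y)⟫ + c(|y|²) {Y, ⟪u₁, ·⟫}(y)`
(viscous part zero; transport part by the polarised Lamb form and `curl_cross_apply` against the tangent divergence-free fields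
`F`, `curl P`; `⟪P, y⟫ = l(l+1) h Y`; `D g[∇Y × y] = −{Y,g}`). [cite: MajdaBertozziCUP2002, §1.1, §2.1] -/
theorem fluxJetTwo_shell_structure (hh : ContDiff ℝ (⊤ : ℕ∞) h) (hY : IsSolidHarmonic l Y) (hl : 1 ≤ l)
    (hPe : P = curl (curl (fun z : E3 => (h (‖z‖ ^ 2) * Y z) • z)))
    (hP : ContDiff ℝ (⊤ : ℕ∞) P) (hdiv : VectorCalculus.IsDivFree P) (hp : ContDiff ℝ (⊤ : ℕ∞) p)
    (hω : curl P = fun y : E3 => -(c (‖y‖ ^ 2) • cross (gradient Y y) y)) (y : E3) :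
    ThreadingJets.fluxJetTwo P p 0 y =
      ((l : ℝ) * ((l : ℝ) + 1)) * h (‖y‖ ^ 2) * inner ℝ (gradient Y y) (curl (ThreadingJets.nsTendency P p) y)
        + c (‖y‖ ^ 2) * pbr Y (fun z : E3 => inner ℝ (ThreadingJets.nsTendency P p z) z) y := by
  -- abbreviations
  obtain ⟨u, hu_def⟩ : ∃ u : E3 → E3, u = ThreadingJets.nsTendency P p := ⟨_, rfl⟩
  obtain ⟨F, hF_def⟩ : ∃ F : E3 → E3, F = curl u := ⟨_, rfl⟩
  have hus : ContDiff ℝ (⊤ : ℕ∞) u := by rw [hu_def]; exact contDiff_nsTendency hP hdiv hp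
  have hud : Differentiable ℝ u := hus.differentiable (by simp)
  have hFs : ContDiff ℝ (⊤ : ℕ∞) F := by
    have : ContDiff ℝ ((⊤ : ℕ∞) + 1) u := by simpa using hus
    rw [hF_def]; exact contDiff_curl this
  have hFd : Differentiable ℝ F := hFs.differentiable (by simp)
  have hPd : Differentiable ℝ P := hP.differentiable (by simp)
  have hP2 : ContDiff ℝ 2 P := hP.of_le (by norm_cast)
  have hωd : Differentiable ℝ (curl P) := by
    have : ContDiff ℝ ((⊤ : ℕ∞) + 1) P := by simpa using hP
    exact (contDiff_curl this).differentiable (by simp)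
  -- tangency and solenoidality of `F` and `curl P`
  have hFtan : ∀ z : E3, inner ℝ (F z) z = 0 := fun z => by
    rw [hF_def, hu_def]; exact inner_curl_nsTendency_self_eq_zero hh hY hl hPe hP hdiv hp z
  have hωtan : ∀ z : E3, inner ℝ (curl P z) z = 0 := fun z => by
    rw [hω]; simp only [inner_neg_left, inner_smul_left, inner_cross_self_right, mul_zero, neg_zero]
  have hdivF : VectorCalculus.divergence F y = 0 := by
    rw [hF_def]; exact divergence_curl_eq_zero_holds u (hus.of_le (by norm_cast)) y
  have hdivω : VectorCalculus.divergence (curl P) y = 0 := divergence_curl_eq_zero_holds P hP2 y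
  -- the second jet, split
  have hΔu : Differentiable ℝ (Δ u) :=
    (contDiff_laplacian (n := 1) (hus.of_le (by norm_cast))).differentiable (by simp)
  have hconv : Differentiable ℝ (fun z : E3 => convect P u z + convect u P z) := by
    have e : (fun z : E3 => convect P u z + convect u P z) =
        fun z => fderiv ℝ u z (P z) + fderiv ℝ P z (u z) := by
      funext z; simp only [convect_apply]
    rw [e]
    have h1 : ContDiff ℝ (⊤ : ℕ∞) (fun z : E3 => fderiv ℝ u z (P z)) :=
      (hus.fderiv_right (m := (⊤ : ℕ∞)) le_rfl).clm_apply hP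
    have h2 : ContDiff ℝ (⊤ : ℕ∞) (fun z : E3 => fderiv ℝ P z (u z)) :=
      (hP.fderiv_right (m := (⊤ : ℕ∞)) le_rfl).clm_apply hus
    exact (h1.add h2).differentiable (by simp)
  have hjet : ThreadingJets.fluxJetTwo P p 0 y =
      inner ℝ (curl (Δ u) y) y - inner ℝ (curl (fun z : E3 => convect P u z + convect u P z) y) y := by
    unfold ThreadingJets.fluxJetTwo
    rw [← hu_def, sub_zero, ← inner_sub_left, ← curl_sub (hΔu y) (hconv y)]
  rw [hjet, hu_def, inner_curl_laplacian_nsTendency_self_eq_zero hh hY hl hPe hP hdiv hp y, ← hu_def, zero_sub]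
  -- polarised Lamb form: `(P·∇)u + (u·∇)P = ∇⟪P,u⟫ − P × F − u × ω`
  have hlamb : (fun z : E3 => convect P u z + convect u P z) =
      fun z => gradient (fun w : E3 => inner ℝ (P w) (u w)) z - cross (P z) (F z) - cross (u z) (curl P z) := by
    funext z
    rw [polarized_lamb (hPd z) (hud z), hF_def]
  have hg2 : ContDiff ℝ 2 (fun w : E3 => inner ℝ (P w) (u w)) := (hP2.inner ℝ (hus.of_le (by norm_cast)))
  have hgd : Differentiable ℝ (gradient (fun w : E3 => inner ℝ (P w) (u w))) := by
    have h1 : ContDiff ℝ 1 (fderiv ℝ (fun w : E3 => inner ℝ (P w) (u w))) := hg2.fderiv_right (m := 1) (by norm_cast)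
    exact (InnerProductSpace.toDual ℝ E3).symm.differentiable.comp (h1.differentiable (by simp))
  have hc1 : Differentiable ℝ (fun z : E3 => cross (P z) (F z)) := fun z =>
    (hasFDerivAt_cross (hPd z).hasFDerivAt (hFd z).hasFDerivAt).differentiableAt
  have hc2 : Differentiable ℝ (fun z : E3 => cross (u z) (curl P z)) := fun z =>
    (hasFDerivAt_cross (hud z).hasFDerivAt (hωd z).hasFDerivAt).differentiableAt
  have hd1 : DifferentiableAt ℝ (fun z : E3 => gradient (fun w : E3 => inner ℝ (P w) (u w)) z - cross (P z) (F z)) y :=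
    (hgd y).sub (hc1 y)
  rw [hlamb, curl_sub hd1 (hc2 y), curl_sub (hgd y) (hc1 y), curl_gradient_eq_zero_holds _ hg2 y, zero_sub]
  -- the two transport terms
  have hT1 : inner ℝ (curl (fun z : E3 => cross (P z) (F z)) y) y =
      inner ℝ (fderiv ℝ P y (F y)) y + inner ℝ (P y) (F y) := by
    rw [curl_cross_apply (hPd y) (hFd y), hdivF, hdiv y, zero_smul, zero_smul, sub_zero, add_zero, inner_sub_left,
      inner_fderiv_of_tangent (hFd y) hFtan]
    rw [real_inner_comm (P y) (F y)]
    ring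
  have hT2 : inner ℝ (curl (fun z : E3 => cross (u z) (curl P z)) y) y =
      inner ℝ (fderiv ℝ u y (curl P y)) y + inner ℝ (u y) (curl P y) := by
    rw [curl_cross_apply (hud y) (hωd y), hdivω, zero_smul, add_zero, inner_sub_left, inner_sub_left, inner_smul_left,
      hωtan y, mul_zero, sub_zero, inner_fderiv_of_tangent (hωd y) hωtan]
    rw [real_inner_comm (u y) (curl P y)]
    ring
  rw [inner_sub_left, inner_neg_left, hT1, hT2]
  -- `⟪DP[F], y⟫ + ⟪P, F⟫ = D⟪P, ·⟫[F] = L h ⟪∇Y, F⟫`  and  `⟪Du[ω], y⟫ + ⟪u, ω⟫ = D⟪u,·⟫[ω] = c {Y, ⟪u,·⟫}`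
  have hm : (fun z : E3 => inner ℝ (P z) z) = fun z => ((l : ℝ) * ((l : ℝ) + 1)) * (h (‖z‖ ^ 2) * Y z) := by
    funext z
    rw [hPe]
    exact inner_curl_curl_shell_self (hh.of_le (by norm_cast)) hY hl z
  have hmd : HasFDerivAt (fun z : E3 => inner ℝ (P z) z)
      ((fderivInnerCLM ℝ (P y, y)).comp ((fderiv ℝ P y).prod (ContinuousLinearMap.id ℝ E3))) y :=
    (hPd y).hasFDerivAt.inner ℝ (hasFDerivAt_id y)
  have hkey1 : inner ℝ (fderiv ℝ P y (F y)) y + inner ℝ (P y) (F y) =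
      fderiv ℝ (fun z : E3 => ((l : ℝ) * ((l : ℝ) + 1)) * (h (‖z‖ ^ 2) * Y z)) y (F y) := by
    rw [← hm, hmd.fderiv]
    simp only [ContinuousLinearMap.comp_apply, ContinuousLinearMap.prod_apply, ContinuousLinearMap.id_apply,
      fderivInnerCLM_apply]
    ring
  have hhd : Differentiable ℝ h := hh.differentiable (by simp)
  have hYd : Differentiable ℝ Y := hY.contDiff.differentiable (by simp)
  have hH : HasFDerivAt (fun z : E3 => h (‖z‖ ^ 2)) (deriv h (‖y‖ ^ 2) • (2 • innerSL ℝ y)) y :=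
    ((hhd (‖y‖ ^ 2)).hasDerivAt).comp_hasFDerivAt y (hasStrictFDerivAt_norm_sq y).hasFDerivAt
  have hprod : HasFDerivAt (fun z : E3 => h (‖z‖ ^ 2) * Y z)
      (h (‖y‖ ^ 2) • fderiv ℝ Y y + Y y • (deriv h (‖y‖ ^ 2) • (2 • innerSL ℝ y))) y :=
    hH.mul (hYd y).hasFDerivAt
  have hFy : (innerSL ℝ y) (F y) = 0 := by rw [innerSL_apply_apply, real_inner_comm]; exact hFtan y
  have hval1 : fderiv ℝ (fun z : E3 => ((l : ℝ) * ((l : ℝ) + 1)) * (h (‖z‖ ^ 2) * Y z)) y (F y) =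
      ((l : ℝ) * ((l : ℝ) + 1)) * h (‖y‖ ^ 2) * inner ℝ (gradient Y y) (F y) := by
    rw [fderiv_const_mul hprod.differentiableAt, hprod.fderiv]
    have e : fderiv ℝ Y y (F y) = inner ℝ (gradient Y y) (F y) := by
      rw [gradient, InnerProductSpace.toDual_symm_apply]
    simp only [smul_apply, add_apply, smul_eq_mul, hFy, mul_zero, smul_zero, add_zero]
    rw [e]
    ring
  have hmu : HasFDerivAt (fun z : E3 => inner ℝ (u z) z)
      ((fderivInnerCLM ℝ (u y, y)).comp ((fderiv ℝ u y).prod (ContinuousLinearMap.id ℝ E3))) y :=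
    (hud y).hasFDerivAt.inner ℝ (hasFDerivAt_id y)
  have hkey2 : inner ℝ (fderiv ℝ u y (curl P y)) y + inner ℝ (u y) (curl P y) =
      fderiv ℝ (fun z : E3 => inner ℝ (u z) z) y (curl P y) := by
    rw [hmu.fderiv]
    simp only [ContinuousLinearMap.comp_apply, ContinuousLinearMap.prod_apply, ContinuousLinearMap.id_apply,
      fderivInnerCLM_apply]
    ring
  have hωy : curl P y = -(c (‖y‖ ^ 2) • cross (gradient Y y) y) := congrFun hω y
  have hval2 : fderiv ℝ (fun z : E3 => inner ℝ (u z) z) y (curl P y) =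
      c (‖y‖ ^ 2) * pbr Y (fun z : E3 => inner ℝ (u z) z) y := by
    rw [hωy, map_neg, map_smul, fderiv_apply_cross_gradient_eq_neg_pbr, smul_eq_mul]
    ring
  rw [← hF_def]
  linarith [hkey1, hval1, hkey2, hval2, real_inner_comm (F y) (P y), real_inner_comm (curl P y) (u y)]

end Shell

end Summit.NavierStokesRegularity.NavierStokesRegularity.Theorems.UnthreadedRigidity.VirialHorn
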